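import Mathlib
import HarnessLib
import Summits.NavierStokesRegularity.NavierStokesRegularity.Theorems.PoloidalWindowDoorLrcModEntireJetCertGaugeV
import Summits.NavierStokesRegularity.NavierStokesRegularity.Theorems.PoloidalWindowDoorLrcModEntireJetCertGaugeCancel

/-!
# Route `PoloidalWindowDoor`, item `LrcModEntire` (stmt-NavierStokesRegularity-20428) — certificate checker: CANCELLATION STEPS and SPLIT-FREE CHAINS for local
# data with point-zero AND point-value letters (the RS gauge of twist_split v4.3)

Cell ns-regularity-ideate, seat ns-k2-port-2 g0 (second kernel porter under the LEAD of item 20428, ns-poloidal-K2-p3 g9; `--supports stmt-NavierStokesRegularity-20428`).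
The `LocalDatumZV` analogue of `…JetCertGaugeCancel` (LEAD K2-p3 g8): an engine that pseudo-divides by a pivot (a monomial in the pins) certifies `(Π pinsᵉ)·P`;
`P` joins the hypotheses (same base point, so zero AND value letters survive).  With `LocalDatumZV.extendS` (plain chunk), `LocalDatumZV.cancelS` (this file)
and the value-gauged leaf `LocalDatumZV.false_of_leaf`, every SPLIT-FREE Ritt–Thomas chain in the full normal-form gauge is checkable: `gaugedChainCheckV` folds
the chunk / cancel items of `…JetCertGaugeCancel.ChainItem` and a final value-gauged leaf; `LocalDatumZV.false_of_gaugedChain` is its soundness.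
WHAT THIS IS NOT: not a claim about Navier–Stokes and not a certificate. [folklore]
-/

noncomputable section

-- the summit and its single sub-problem share the name (CONVENTIONS §1), as in every Theorems file
set_option linter.dupNamespace false

namespace Summit.NavierStokesRegularity.NavierStokesRegularity.Theorems.PoloidalWindowDoorLrcModEntireJetCertGaugeVCancel

open _root_.Topology _root_.Filter Set
open Literature.Analysis.ValidatedNumerics Literature.Analysis.ValidatedNumerics.QMvPoly
open Literature.Analysis.Calculus.MvPoly
open Summit.NavierStokesRegularity.NavierStokesRegularity.Theorems.PoloidalWindowDoorLrcModEntireJetCertDefs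
open Summit.NavierStokesRegularity.NavierStokesRegularity.Theorems.PoloidalWindowDoorLrcModEntireJetCertMasked
open Summit.NavierStokesRegularity.NavierStokesRegularity.Theorems.PoloidalWindowDoorLrcModEntireJetCertTree
open Summit.NavierStokesRegularity.NavierStokesRegularity.Theorems.PoloidalWindowDoorLrcModEntireJetCertFast2
open Summit.NavierStokesRegularity.NavierStokesRegularity.Theorems.PoloidalWindowDoorLrcModEntireJetCertCancel
open Summit.NavierStokesRegularity.NavierStokesRegularity.Theorems.PoloidalWindowDoorLrcModEntireJetCertGauge
open Summit.NavierStokesRegularity.NavierStokesRegularity.Theorems.PoloidalWindowDoorLrcModEntireJetCertGaugeV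
open Summit.NavierStokesRegularity.NavierStokesRegularity.Theorems.PoloidalWindowDoorLrcModEntireJetCertGaugeCancel

variable {E : Type*} [NormedAddCommGroup E] [NormedSpace ℝ E] {n : ℕ}

/-- **CANCELLATION with zero and value letters**: a derivation certifying `(Π pinsᵉ)·P` from the hypotheses makes `P` a hypothesis law of a `LocalDatumZV`
with the same tables, pins, base point, zero and value letters (on the open neighbourhood of the base point where the pin monomial does not vanish). [folklore] -/
theorem LocalDatumZV.cancelS {S : ℕ → ℕ → QMvPoly} {M : ℕ → ℕ → Bool} {v : ℕ → E} {hyps pins : List QMvPoly} {zs : List ℕ} {vals : List (ℕ × ℚ)}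
    (hdat : LocalDatumZV (E := E) n S M v hyps pins zs vals) {cert : List (List (QMvPoly × ℕ × List ℕ))} {k : ℕ} {e : List ℕ} {P : QMvPoly}
    (hcheck : certCheckS n S M hyps cert k (QMvPoly.mul (pinProduct pins e) P) = true) :
    LocalDatumZV (E := E) n S M v (hyps ++ [P]) pins zs vals := by
  obtain ⟨U, p₀, g, hU, hp₀, hg, hS, hhyps, hpins, hz, hv⟩ := hdat
  have hprod : ∀ x ∈ U, ev n (pinProduct pins e) (g x) * ev n P (g x) = 0 := by
    intro x hx
    rw [← ev_mul]
    exact ev_eq_zero_of_certCheckS hU hg hS hhyps hcheck x hx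
  have hne : ev n (pinProduct pins e) (g p₀) ≠ 0 := ev_pinProduct_ne_zero (g p₀) pins e hpins
  have hev : ∀ᶠ x in 𝓝 p₀, ev n (pinProduct pins e) (g x) ≠ 0 :=
    (continuousAt_ev_comp (hg p₀ hp₀) (pinProduct pins e)).eventually_ne hne
  obtain ⟨V, hVsub, hVo, hp₀V⟩ := mem_nhds_iff.1 hev
  refine ⟨U ∩ V, p₀, g, hU.inter hVo, ⟨hp₀, hp₀V⟩, fun x hx => hg x hx.1, fun j i hi x hx => hS j i hi x hx.1, ?_, hpins, hz, hv⟩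
  intro L hL x hx
  rcases List.mem_append.1 hL with h | h
  · exact hhyps L h x hx.1
  · rw [List.mem_singleton.1 h]
    have h1 := hprod x hx.1
    have h2 : ev n (pinProduct pins e) (g x) ≠ 0 := hVsub hx.2
    rcases mul_eq_zero.1 h1 with h0 | h0
    · exact absurd h0 h2
    · exact h0

/-! ### Split-free chains with a value-gauged leaf -/

/-- **THE VALUE-GAUGED CHAIN CHECK**: fold the items of `…JetCertGaugeCancel.ChainItem` (each against the hypotheses extended by the earlier items' laws),
then the value-gauged leaf `leafCheckZV`. [folklore] -/
def gaugedChainCheckV (n : ℕ) (S : ℕ → ℕ → QMvPoly) (M : ℕ → ℕ → Bool) (pins : List QMvPoly) (zs : List ℕ) (vals : List (ℕ × ℚ)) :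
    List QMvPoly → List ChainItem → List (List (QMvPoly × ℕ × List ℕ)) → ℕ → List ℕ → Bool
  | hyps, [], steps, k, e => leafCheckZV n S M hyps pins zs vals steps k e
  | hyps, it :: items, steps, k, e => it.check n S M hyps pins && gaugedChainCheckV n S M pins zs vals (hyps ++ [it.law]) items steps k e

/-- **SOUNDNESS OF SPLIT-FREE VALUE-GAUGED CHAINS.** [folklore] -/
theorem LocalDatumZV.false_of_gaugedChain {S : ℕ → ℕ → QMvPoly} {M : ℕ → ℕ → Bool} {v : ℕ → E} {pins : List QMvPoly} {zs : List ℕ}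
    {vals : List (ℕ × ℚ)} :
    ∀ (items : List ChainItem) (hyps : List QMvPoly) (steps : List (List (QMvPoly × ℕ × List ℕ))) (k : ℕ) (e : List ℕ),
      gaugedChainCheckV n S M pins zs vals hyps items steps k e = true → LocalDatumZV (E := E) n S M v hyps pins zs vals → False := by
  intro items
  induction items with
  | nil =>
    intro hyps steps k e hc hdat
    exact LocalDatumZV.false_of_leaf hdat (by simpa [gaugedChainCheckV] using hc)
  | cons it items ih =>
    intro hyps steps k e hc hdat
    simp only [gaugedChainCheckV, Bool.and_eq_true] at hc
    obtain ⟨h1, h2⟩ := hc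
    cases it with
    | chunk cert k' T =>
      exact ih (hyps ++ [T]) steps k e h2 (LocalDatumZV.extendS hdat (by simpa [ChainItem.check] using h1))
    | cancel cert k' e' P =>
      exact ih (hyps ++ [P]) steps k e h2 (LocalDatumZV.cancelS hdat (by simpa [ChainItem.check] using h1))

end Summit.NavierStokesRegularity.NavierStokesRegularity.Theorems.PoloidalWindowDoorLrcModEntireJetCertGaugeVCancel

end
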